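import Summits.ABC.IUTFork.Thm311RealInd1StripPacketMonomialBoxSharp
import HarnessLib

/-!
# [IUTchIII] Thm 3.11 (i) (Ind1)+(Ind2): the monomial-floor ROOM INEQUALITY of R25 is SHARP at EVERY factor count and EVERY residue — bits only on `S` + room
# FAILING ⟹ the hull of every factorwise-strip orbit of `ι_{i₀}(g)·(R_I)^∼` is NOT the container `packetHull(p^{A}·log_p(R_I^×))` (UNCONDITIONAL)

PROOF-ONLY file (abc-iut cell, Cor. 3.12 sub-crew, seat abc-iut-c312-1 = holder of record of the typed [IUTchIII] Thm. 3.11, gen 19; row «R26 = C:ROOM-SHARPNESS»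
item (θ3), KEY ROOMSHARP, C LEAD ruling C-R171 (a) ff.; file (κ3′), sequel of `Thm311RealInd1StripPacketMonomialBoxSharp`).  TAKES NO SIDE on [IUTchIII] Cor. 3.12.
No definition, no `Prop` fact, NO `JannsenWingbergMappingClass`.
* §1 **`prodRadius_lt_container_of_not_room`** — the confinement radius `R′_S = ∏_i p^{−[i=i₀]v/e_i + 1 − 1/e_i − [i∉S]/e_i}` of `…MonomialBoxSharp` §2 is
  STRICTLY below the container's attained radius `R = ‖p^{A}‖·∏_i p^{−1/e_i}` (`A = (v−1) div E + 1 − |I|`) EXACTLY WHEN R25 (A) §2's room inequality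
  `((v−1) % E + 1)/E + Σ_{i ∈ univ ∖ S} 1/e_i ≤ 1` FAILS: `log_p R′_S − log_p R = (r+1)/E + Σ_{i∉S} 1/e_i − 1` (`v − 1 = E·B + r`).
* §2 **`packetHull_orbit_ne_container_of_not_room`** — THE CONVERSE OF THE MONOMIAL FLOOR, any `|I|`, any `r`, UNCONDITIONAL: at a genuine packet of tame
  residue-degree-one factors (`e_i ≥ 2`), bits available only on `S` (failing off `S`, `hfix`) and the room inequality failing (VERBATIM, negated) ⟹ for every
  factorwise-strip `H` the `(R_I)^∼`-hull of the `H`-orbit of `ι_{i₀}(g)·(R_I)^∼` is NOT `packetHull(p^{A}·log_p(R_I^×))` (§1 + `…MonomialBoxSharp` §2 + R25 (B′) §5).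
  With R25 (A) §2 (room ⟹ identity, mod hMC, `H ≤ indTwo` ∋ strip moves) the room inequality is the EXACT threshold of the junction identity at every factor count
  and every residue: R26's flagged strip is CLOSED.
READING (numbers about OUR typed objects; neutral); which value a bit takes is NOT claimed; HONEST SCOPE: unconditional; tame residue-degree-one factors; OUR typings (THE
equivariant lift, THE logarithm, factorwise action; F-B28-1 untouched); EVEN degree, WILD, `p = 2`, `f > 1` outside; equal-AS-TYPED ≠ equal in print; nothing here asserts
that abc is proved or refuted; no side taken on [IUTchIII] Cor. 3.12 / [IUTchIV] Thm. 1.10, on (U) vs (P), or on any author. [claim: Mochizuki2012, status: disputed];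
[cite: Mochizuki2012, IUTchIII Thm. 3.11 (i) p. 154; Rmk. 3.9.5 (i) p. 127; Cor. 3.12 Step (xi) p. 183; IUTchIV Prop. 1.1 p. 9, Prop. 1.2 (ii) pp. 10–11, Prop. 1.4 (i) p. 13];
[cite: DupuyHilado2025, §4.9, §4.12]. typed ≠ proved.
-/

set_option autoImplicit false

noncomputable section

open Metric Set Bornology Function
open scoped Pointwise TensorProduct NormedField

namespace Summit.ABC.IUTFork.Thm311.Real

open NumberField IsDedekindDomain Literature.NumberTheory.NumberFields Literature.IUT.LogVolume
open Literature.NumberTheory.GaloisRepresentations Literature.NumberTheory.GaloisRepresentations.Ultrametric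
open Literature.AnabelianGeometry.AbsoluteAnabelian Literature.IUT.HodgeArakelov
open Literature.IUT.HodgeArakelov.AbsTopMonoids

variable {K : Type} [Field K] [NumberField K] (p : ℕ) [hp : Fact p.Prime]
variable {I : Type} [Fintype I] [DecidableEq I] (w : I → HeightOneSpectrum (𝓞 K)) (hw : ∀ i, ((p : ℕ) : 𝓞 K) ∈ (w i).asIdeal)

/-! ## §1 The confinement radius is below the container radius exactly when the room inequality fails -/

/-- **`R′_S < R` under the failing room inequality.**  `R′_S = ∏_i p^{−[i=i₀]v/e_i + 1 − 1/e_i − [i∉S]/e_i}` and `R = ‖p^{A}‖·∏ p^{−1/e_i}`, `A = (v−1) div E + 1 − |I|`: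
`log_p R′_S = −v/E + |I| − Σ_i 1/e_i − Σ_{i∉S} 1/e_i` and `log_p R = −B − 1 + |I| − Σ_i 1/e_i` (`v − 1 = E·B + r`), so `R′_S < R` iff
`(r+1)/E + Σ_{i∉S} 1/e_i > 1`. [cite: Mochizuki2012, IUTchIV Prop. 1.2 (ii) p. 10] -/
theorem prodRadius_lt_container_of_not_room (i₀ : I) (v : ℤ) (S : Finset I)
    (hnotroom : ¬ ((((v - 1) % (absRamificationIdx p (RescaledCompletion K p (w i₀) (hw i₀)) : ℤ) + 1 : ℤ) : ℝ) /
        (absRamificationIdx p (RescaledCompletion K p (w i₀) (hw i₀)) : ℝ) +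
      ∑ i ∈ Finset.univ \ S, (1 : ℝ) / (absRamificationIdx p (RescaledCompletion K p (w i) (hw i)) : ℝ) ≤ 1)) :
    ∏ i, (p : ℝ) ^ (-(if i = i₀ then (v : ℝ) else 0) / (absRamificationIdx p (RescaledCompletion K p (w i) (hw i)) : ℝ) +
        (1 - 1 / (absRamificationIdx p (RescaledCompletion K p (w i) (hw i)) : ℝ) -
          if i ∈ S then 0 else 1 / (absRamificationIdx p (RescaledCompletion K p (w i) (hw i)) : ℝ))) <
      ‖(p : ℚ_[p]) ^ ((v - 1) / (absRamificationIdx p (RescaledCompletion K p (w i₀) (hw i₀)) : ℤ) + 1 - Fintype.card I)‖ *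
        ∏ i, (p : ℝ) ^ (-(1 / (absRamificationIdx p (RescaledCompletion K p (w i) (hw i)) : ℝ))) := by
  classical
  set E : ℕ := absRamificationIdx p (RescaledCompletion K p (w i₀) (hw i₀)) with hE
  set ee : I → ℝ := fun i => (absRamificationIdx p (RescaledCompletion K p (w i) (hw i)) : ℝ) with hee
  have hP : p.Prime := Fact.out
  have hp0 : (0 : ℝ) < p := by exact_mod_cast hP.pos
  have hp1 : (1 : ℝ) < p := by exact_mod_cast hP.one_lt
  have hEpos : 0 < E := absRamificationIdx_pos p _
  have hEz : (0 : ℤ) < (E : ℤ) := by exact_mod_cast hEpos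
  have hE0 : (0 : ℝ) < (E : ℝ) := by exact_mod_cast hEpos
  -- `v − 1 = E·B + r`
  set B : ℤ := (v - 1) / (E : ℤ) with hB
  set r : ℤ := (v - 1) % (E : ℤ) with hr
  have hvR : (v : ℝ) = (E : ℝ) * B + r + 1 := by
    have hvar : v - 1 = (E : ℤ) * B + r := by rw [hr, Int.emod_def]; ring
    have h1 : v = (E : ℤ) * B + r + 1 := by omega
    exact_mod_cast h1
  -- both sides as single powers of `p`
  rw [← Real.rpow_sum_of_pos hp0, ← Real.rpow_sum_of_pos hp0, norm_zpow, Padic.norm_p, inv_zpow', ← Real.rpow_intCast, ← Real.rpow_add hp0]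
  refine Real.rpow_lt_rpow_of_exponent_lt hp1 ?_
  -- the exponent sums
  have hsh : ∑ i, (-(if i = i₀ then (v : ℝ) else 0) / ee i) = -(v : ℝ) / (E : ℝ) := by
    rw [Finset.sum_congr rfl (fun i _ => show (-(if i = i₀ then (v : ℝ) else 0) / ee i) = (if i = i₀ then -(v : ℝ) / (E : ℝ) else 0) by
      split_ifs with h
      · subst h; rfl
      · simp), Finset.sum_ite_eq' Finset.univ i₀, if_pos (Finset.mem_univ _)]
  have hS : ∑ i, (if i ∈ S then (0 : ℝ) else 1 / ee i) = ∑ i ∈ Finset.univ \ S, 1 / ee i := by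
    rw [Finset.sum_congr rfl (fun i _ => show (if i ∈ S then (0 : ℝ) else 1 / ee i) = (if i ∈ Finset.univ \ S then 1 / ee i else 0) by
      simp only [Finset.mem_sdiff, Finset.mem_univ, true_and]
      split_ifs <;> rfl), Finset.sum_ite_mem, Finset.univ_inter]
  have hlhs : ∑ i, (-(if i = i₀ then (v : ℝ) else 0) / ee i + (1 - 1 / ee i - if i ∈ S then 0 else 1 / ee i)) =
      -(v : ℝ) / (E : ℝ) + Fintype.card I - ∑ i, 1 / ee i - ∑ i ∈ Finset.univ \ S, 1 / ee i := by
    rw [Finset.sum_add_distrib, hsh, Finset.sum_sub_distrib, Finset.sum_sub_distrib, hS, Finset.sum_const, Finset.card_univ, nsmul_eq_mul, mul_one]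
    ring
  have hrhs : ∑ i, (-(1 / ee i)) = -∑ i, 1 / ee i := by rw [Finset.sum_neg_distrib]
  rw [hlhs, hrhs]
  push_cast
  have hroom' : 1 < ((r : ℝ) + 1) / (E : ℝ) + ∑ i ∈ Finset.univ \ S, 1 / ee i := by
    have h := not_le.mp hnotroom
    have : (((r + 1 : ℤ)) : ℝ) = (r : ℝ) + 1 := by push_cast; ring
    rw [this] at h
    exact h
  have hvE : -(v : ℝ) / (E : ℝ) = -(B : ℝ) - ((r : ℝ) + 1) / (E : ℝ) := by rw [hvR]; field_simp; ring
  rw [hvE]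
  linarith

/-! ## §2 The converse of the monomial floor at every factor count and every residue -/

/-- **THE ROOM INEQUALITY IS SHARP AT EVERY FACTOR COUNT AND EVERY RESIDUE (UNCONDITIONAL).**  Genuine packet `⊗_{i∈I} K_{w_i}` of TAME factors of residue degree
ONE (`e_i ≥ 2`, local degree `≥ 2`); `‖g‖ = p^{−v/E}`; bits available only on `S ⊆ I` (off `S` no realised strip automorphism moves `ℤ_p·p` modulo `p·log_p(𝒪^×)`,
`hfix`); and R25 (A) §2's room inequality FAILS: `¬ ( ((v−1) % E + 1)/E + Σ_{i ∈ univ ∖ S} 1/e_i ≤ 1 )`.  Then for EVERY `H ≤ Aut_{ℚ_p}(X)` acting factorwise through the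
realised strip groups, the `(R_I)^∼`-hull of the `H`-orbit of the Θ-region `ι_{i₀}(g)·(R_I)^∼` is NOT `packetHull(p^{A}·log_p(R_I^×))` — confinement by the monomial box
(`…MonomialBoxSharp` §2) to the radius `R′_S`, `R′_S < R` (§1), and the container span attains `R` (R25 (B′) §5 `packetHull_ne_of_subset_polydisc_of_lt`).
Converse of R25 (A) §2 (bits on `S` + room ⟹ identity, mod hMC): the exact threshold is the room inequality. [claim: Mochizuki2012, status: disputed]
[cite: Mochizuki2012, IUTchIII Thm. 3.11 (i) p. 154; Rmk. 3.9.5 (i) p. 127; Cor. 3.12 Step (xi) p. 183; IUTchIV Prop. 1.1 p. 9, Prop. 1.2 (ii) p. 10] [cite: DupuyHilado2025, §4.9, §4.12] -/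
theorem packetHull_orbit_ne_container_of_not_room (hp2 : 2 < p)
    (he : ∀ i, absRamificationIdx p (RescaledCompletion K p (w i) (hw i)) ≤ p - 2)
    (he2 : ∀ i, 2 ≤ absRamificationIdx p (RescaledCompletion K p (w i) (hw i))) (hd2 : ∀ i, 2 ≤ localDeg K (w i))
    (hf : ∀ i, (w i).asIdeal.inertiaDeg ℤ = 1)
    (i₀ : I) {g : RescaledCompletion K p (w i₀) (hw i₀)} {v : ℤ}
    (hv : ‖g‖ = (p : ℝ) ^ (-(v / (absRamificationIdx p (RescaledCompletion K p (w i₀) (hw i₀)) : ℝ))))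
    (S : Finset I)
    (hfix : ∀ i, i ∉ S → ∀ ψ ∈ ind1StripOf (w i) (galoisLog (w i)),
      RescaledCompletion.of K p (w i) (hw i) (ψ (p : (w i).adicCompletion K)) - (p : RescaledCompletion K p (w i) (hw i)) ∈
        (p : ℚ_[p]) • logUnits (RescaledCompletion K p (w i) (hw i)))
    (hnotroom : ¬ ((((v - 1) % (absRamificationIdx p (RescaledCompletion K p (w i₀) (hw i₀)) : ℤ) + 1 : ℤ) : ℝ) /
        (absRamificationIdx p (RescaledCompletion K p (w i₀) (hw i₀)) : ℝ) +
      ∑ i ∈ Finset.univ \ S, (1 : ℝ) / (absRamificationIdx p (RescaledCompletion K p (w i) (hw i)) : ℝ) ≤ 1))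
    (H : Subgroup (PacketAlgebra p (fun i => RescaledCompletion K p (w i) (hw i)) ≃ₗ[ℚ_[p]]
      PacketAlgebra p (fun i => RescaledCompletion K p (w i) (hw i))))
    (hHfac : ∀ γ ∈ H, ∃ δ : Π i, AddAut ((w i).adicCompletion K),
      (∀ i, δ i ∈ AddSubgroup.closure (G := AddAut ((w i).adicCompletion K)) (ind1StripOf (w i) (galoisLog (w i)))) ∧
      ∀ z : Π i, RescaledCompletion K p (w i) (hw i),
        γ (PiTensorProduct.tprod ℚ_[p] z) =
          PiTensorProduct.tprod ℚ_[p] (fun i => RescaledCompletion.of K p (w i) (hw i)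
            (δ i ((RescaledCompletion.of K p (w i) (hw i)).symm (z i))))) :
    packetHull p (fun i => RescaledCompletion K p (w i) (hw i))
        (⋃ γ : H, (γ : PacketAlgebra p (fun i => RescaledCompletion K p (w i) (hw i)) ≃ₗ[ℚ_[p]]
            PacketAlgebra p (fun i => RescaledCompletion K p (w i) (hw i))) ''
          (iota p (fun i => RescaledCompletion K p (w i) (hw i)) i₀ g •
            (normalizedPacket p (fun i => RescaledCompletion K p (w i) (hw i)) :
              Set (PacketAlgebra p (fun i => RescaledCompletion K p (w i) (hw i)))))) ≠
      packetHull p (fun i => RescaledCompletion K p (w i) (hw i))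
        (((p : ℚ_[p]) ^ ((v - 1) / (absRamificationIdx p (RescaledCompletion K p (w i₀) (hw i₀)) : ℤ) + 1 - Fintype.card I)) •
          (logPacket p (fun i => RescaledCompletion K p (w i) (hw i)) :
            Set (PacketAlgebra p (fun i => RescaledCompletion K p (w i) (hw i))))) := by
  haveI : Nonempty I := ⟨i₀⟩
  exact packetHull_ne_of_subset_polydisc_of_lt p w hw hp2 he hd2 _ (prodRadius_lt_container_of_not_room p w hw i₀ v S hnotroom)
    (packetHull_orbit_smul_normalizedPacket_subset_polydisc_of_fixesBaseLine_off p w hw hp2 he he2 hf i₀ hv S hfix H hHfac)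

end Summit.ABC.IUTFork.Thm311.Real
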